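import Literature.Probability.RandomPlanarGeometry.HexSAWStripBridgeRenewalPointDensity
import Literature.Probability.RandomPlanarGeometry.HexSAWStripBridgeContactDensityPointwise
import HarnessLib

/-!
# The irreducible-bridge kernel of the width-two honeycomb strip in closed form: six bridges, a `4 × 4` polynomial matrix,
# its Perron data, and `ν₂ = √2 − 1/2` renewal vertices per step (module «WIDTH-TWO-KERNEL»)

Topic `Literature/Probability/RandomPlanarGeometry` (continues the strip renewal line: «BRIDGE-RENEWAL» `HexSAWStripBridgeRenewal.lean` — the
Duminil-Copin–Hammond renewal indices `HV.IsRenewalIdx`, the level classes `HV.HBk T N k a b` of standard horizontal bridges (`HV.IsHBridge`: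
`ξ(head) < ξ(v) ≤ ξ(last)`), the truncated kernels `HV.Imat` and `HV.Iinf T y = sup_N Imat T N y`, and the explicit members `HV.pair_mem_HBk`,
`HV.triple_mem_HBk`; «LENGTH-POINTWISE» (`HV.LMM`, `HV.LMset`, `HV.hlen`); «AMPLITUDE-RATIO» #633 (fixed vectors of `Iinf T y_T`); «RENEWAL-POINT-DENSITY»
#692 `HV.tendsto_pieces_per_step` (for every `T ≥ 2`: pieces per step of a critical bridge with `n` steps `→ ν_T = ⟨ℓ,u⟩/⟨ℓ, M̄_len u⟩`);
«CONTACT-DENSITY-POINTWISE» #687 (`θ_T`, and `θ₂ = (3 − √2)/4` from the β-amplitudes); the width-two data `HV.stripYT_two` (`y₂ = (10 + 8√2)/7`),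
`HV.xc_sq_eq_half`, `HV.W2.wdet x y = (1 − x²)(1 − x²y) − x⁶y`).  Lane «pcv-sawmu» (CriticalPhenomena venture), a-p2 g24, HANDOFF-gen23 item 4
(«ν₂ explicit»).  Sources of the SETTING: H. Duminil-Copin, A. Hammond, CMP 324 (2013) §2.2 (bridges, renewal points, irreducible bridges);
H. Duminil-Copin, S. Smirnov, Ann. Math. 175 (2012) §3 (the strip `S_T`, Fig. 3); N. R. Beaton, A. J. Guttmann, I. Jensen, J. Phys. A 45 (2012)
035201, §2 (the transfer matrix of the narrowest strip, their width 1 = the lane's `T = 2`); N. R. Beaton, M. Bousquet-Mélou, J. de Gier,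
H. Duminil-Copin, A. J. Guttmann, CMP 326 (2014), §3.2 and Corollary 8 (surface fugacity, the thresholds `y_T`); W. Feller I (1968) XIII.3, XIII.11;
E. Seneta (1973) §1.4, §6.2.  Nothing below is printed: in print the narrow strip is handled by a `2 × 2` transfer matrix between the two rails
(BGJ 2012), whose entries `x², x³y, x³, x²y` are the rail-to-rail PRODUCTS of two of the six irreducible bridges below.

## What is proved (namespace `Literature.Probability.RandomPlanarGeometry.SAW.HV`, helper objects in `HV.W2`; `x = x_c = hexCriticalFugacity`,
## levels `0,1` = bottom rail, `2,3` = top rail (the surface), column `ξ = 2x₀ + x₁ + b`)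

* §1–§2 `W2.adj_false_iff` / `W2.adj_true_iff` (neighbours), `W2.eq_of_xi_eq_odd/even` (each column of `S₂` holds TWO vertices) and ★ the
  NO-RETURN LEMMA `W2.isRenewalIdx_of_column`: on a self-avoiding bridge of `S₂`, an index `i` with `ξ(l[i+1]) = ξ(l[i]) + 1` whose column is
  «used or dead» behind the walker is a renewal index (`ξ` moves by at most one per step; a dead-end vertex could only be the last one, which the
  bridge condition forbids).
* §3 ★★ `W2.mem_HBk_two_one` — CLASSIFICATION: every member of `HBk 2 N 1 a b` (irreducible standard horizontal bridge of `S₂` from level `a` to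
  level `b`) is one of SIX lists: `W2.irr01 = [(0,0,f),(0,0,t)]`, `W2.irr02 = [(0,0,f),(0,0,t),(0,1,f)]` (rung up), `W2.irr10`, `W2.irr23` (the only
  one touching the surface), `W2.irr32`, `W2.irr31` (rung down); §4 the converse memberships and the level classes as explicit finsets
  (`W2.HBk_two_pair`, `W2.HBk_two_triple`, `W2.HBk_two_empty`, …).
* §5 ★★ `W2.Imat_two_eq` (`N ≥ 2`) and ★★ `W2.Iinf_two_eq` (`y ≥ 0`): **`Iinf 2 y = K(y) := (0,x,x²,0 | x,0,0,0 | 0,0,0,xy | 0,x²,x,0)`** (`W2.kerTwo`) —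
  the critical irreducible kernel of `S₂` is a polynomial matrix (all contact / length moments finite at every `y`).
* §6 ★★ `W2.LMM_two_eq`: the length grading `LMM 2 n n y` is `M(1)(y)` (`W2.lenOneTwo`), `M(2)` (`W2.lenTwoTwo`), `0` for `n ∉ {1,2}`; `W2.tsum_mul_LMM_two`,
  `W2.lengthMomentMatrix_two_eq`: `Σ_n n·M(n) = M̄_len(y)` (`W2.lenMomTwo`).
* §7 Perron data at `y₂` in `ℚ(x_c)` (`2x⁴ − 4x² + 1 = 0`, `W2.xc_minpoly`; `7y₂ = 26 − 16x²`): ★ `W2.uTwo = (10x − 4x³, 2 + 2x², 26x − 16x³, 7)`,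
  `W2.ellTwo = (x − 2x³, 1 − 2x², 2x − 3x³, 1)`, positive (`W2.uTwo_pos`, `W2.ellTwo_pos`), ★★ `W2.kerTwo_fixed` / `W2.Iinf_two_fixed` (`K u = u`, `ℓ K = ℓ`,
  hence fixed vectors of the TREE's `Iinf 2 y₂`), `W2.perron_scalars_two` (`⟨ℓ,u⟩ = 22 − 20x²`, `⟨ℓ, M̄_len u⟩ = 20 − 8x²`);
  §7b `W2.tsum_contactLMset_two` / `W2.contactMomentMatrix_two_eq` (the contact-weighted irreducible mass is the single entry `xy` at `(2,3)`) and
  ★ `W2.contact_scalar_two`: `⟨ℓ, C̄_M u⟩ = 7` and `4·⟨ℓ, C̄_M u⟩ = (3 − √2)·⟨ℓ, M̄_len u⟩` — the kernel REPRODUCES `θ₂ = (3 − √2)/4` of #687, which was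
  obtained from the β-walk amplitudes `Λ₂ = (45 + √2)/28`, `Λℓ₂ = (19 − 6√2)/8` without any kernel (two independent routes, one number);
  §7c ★★ `W2.det_one_sub_kerTwo`: **`det(1 − K(y)) = W2.wdet x_c y`** — the renewal kernel's characteristic determinant IS the transfer-matrix
  determinant of the tree's solved width-two strip.
* §8 ★★★ `HV.widthTwo_pieces_per_step` — **`P̂(k)_{ab}/(n_k · D̂(k)_{ab}) → √2 − 1/2 = 0.91421…`** for every pair of levels: a critical bridge of `S₂`
  with exactly `n` steps has `(√2 − ½)n + o(n)` irreducible pieces; mean steps per piece `(2 + 4√2)/7 = 1.0938…`; with #687, contacts per piece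
  `θ₂/ν₂ = (5√2 − 1)/14`.

Finite-data faces (lane desks, 2026-08-27, before filing): FIRST-A a-ref-2 g57 reproduced §7–§8's scalars from `K` alone to 50 digits and
`det(1 − K) ≡ W2.wdet`; A-SECOND a-ref-1 g66 enumerated, from the tree's definitions only, all 1618 standard bridges of `S₂` with `≤ 18` vertices
(and all with `≤ 35`): exactly the six irreducible ones, kernel rows as in §5, and the exact pieces-per-step statistic at `n ≤ 34` approaching
`0.9142136` with `n·(stat − ν₂)` constant to three decimals.

Label: LANE THEOREM (own result of lane «pcv-sawmu», a-p2 g24, 2026-08-27): an explicit finite classification + closed-form linear algebra over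
`ℚ(x_c)` (identities certified by `linear_combination` with coefficients computed in exact arithmetic) feeding the tree's all-`T` renewal theorems.
NOT claimed: anything for `T ≥ 3` (there irreducible bridges of every length exist), uniqueness of the Perron vectors (not needed: #633/#692 hold
for ANY positive fixed vectors), the head/tail (β-walk) pieces of `S₂`, a variance or law of large numbers for the piece count.
-/

noncomputable section

open Finset Filter Topology Matrix Literature.Probability.LatticeModels Literature.Probability.Percolation
  Literature.Analysis.Matrix

namespace Literature.Probability.RandomPlanarGeometry.SAW

namespace HV

namespace W2

/-! ### §1 Two lattice lemmas: the neighbours of a vertex, the columns of `S₂` -/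

/-- The three neighbours of an up-triangle vertex `(a, b, false)` of `ℍ`. [cite: DuminilCopinSmirnov2012, §3 (Fig. 3: the lattice ℍ)] -/
theorem adj_false_iff {a b : ℤ} {v : HV} :
    hvGraph.Adj (a, b, false) v ↔ v = (a, b, true) ∨ v = (a - 1, b, true) ∨ v = (a, b - 1, true) := by
  obtain ⟨a', b', c'⟩ := v
  cases c' <;> simp [hvGraph_adj, AdjRel]

/-- The three neighbours of a down-triangle vertex `(a, b, true)` of `ℍ`. [cite: DuminilCopinSmirnov2012, §3 (Fig. 3: the lattice ℍ)] -/
theorem adj_true_iff {a b : ℤ} {v : HV} :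
    hvGraph.Adj (a, b, true) v ↔ v = (a, b, false) ∨ v = (a + 1, b, false) ∨ v = (a, b + 1, false) := by
  obtain ⟨a', b', c'⟩ := v
  cases c' <;> simp [hvGraph_adj, AdjRel]

/-- The columns of `S₂` have two vertices each: column `2a + 1` (odd) = `{(a, 0, true), (a, 1, false)}` (levels `1, 2`, the ends of a rung).
[cite: DuminilCopinSmirnov2012, §3 (Fig. 3: the strip S_T)] -/
theorem eq_of_xi_eq_odd {v : HV} (h0 : 0 ≤ lev v) (h3 : lev v ≤ 2 * (2 : ℕ) - 1) (a : ℤ) (hc : xi v = 2 * a + 1) :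
    v = (a, 0, true) ∨ v = (a, 1, false) := by
  obtain ⟨a', b', c'⟩ := v
  cases c' <;> simp [xi, bit] at h0 h3 hc ⊢ <;> omega

/-- Column `2a` (even) of `S₂` = `{(a, 0, false), (a − 1, 1, true)}` (levels `0, 3`). [cite: DuminilCopinSmirnov2012, §3 (Fig. 3: the strip S_T)] -/
theorem eq_of_xi_eq_even {v : HV} (h0 : 0 ≤ lev v) (h3 : lev v ≤ 2 * (2 : ℕ) - 1) (a : ℤ) (hc : xi v = 2 * a) :
    v = (a, 0, false) ∨ v = (a - 1, 1, true) := by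
  obtain ⟨a', b', c'⟩ := v
  cases c' <;> simp [xi, bit] at h0 h3 hc ⊢ <;> omega

/-! ### §2 The no-return lemma: a used-or-dead column behind the walker is a renewal column -/

/-- `l[k] ∈ l.tail` for `k ≥ 1` (plumbing). [cite: DuminilCopinHammond2013, §2.2 (bridges as vertex lists); lane plumbing] -/
theorem getElem_mem_tail {l : List HV} {k : ℕ} (hk : 0 < k) (hkl : k < l.length) : l[k] ∈ l.tail := by
  obtain ⟨m, rfl⟩ : ∃ m, k = m + 1 := ⟨k - 1, by omega⟩
  have h : m < l.tail.length := by rw [List.length_tail]; omega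
  have := List.getElem_mem h
  rwa [List.getElem_tail] at this

/-- **No-return lemma** (`S₂`).  Let `l` be a self-avoiding horizontal bridge of `S₂`, `0 < i`, `ξ(l[i]) = c ≥ ξ(l[j])` (`j < i`), `ξ(l[i+1]) = c + 1`,
and suppose the column `c` of the strip consists of `l[i]` and one more vertex `q` which is either used before `i` or a dead end (all its admissible
neighbours — in the strip, to the right of the start column, other than `l[i]` — coincide).  Then `i` is a renewal index: the walk never returns to
column `c` (self-avoidance + the bridge condition at a dead end), and `ξ` moves by at most one per step. [cite: DuminilCopinHammond2013, §2.2 (renewal points of a bridge); lane «pcv-sawmu» a-p2 g24] -/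
theorem isRenewalIdx_of_column {l : List HV} (hc : l.IsChain hvGraph.Adj) (hnd : l.Nodup) (hB : IsHBridge l) (hin : InLev 2 l)
    {i : ℕ} (hi0 : 0 < i) (hi : i + 1 < l.length) {c : ℤ} (hci : xi l[i] = c)
    (hbef : ∀ j, ∀ hj : j < i, xi (l[j]'(by omega)) ≤ c) (hnext : xi l[i + 1] = c + 1) (q : HV)
    (hcol : ∀ v : HV, 0 ≤ lev v → lev v ≤ 2 * (2 : ℕ) - 1 → xi v = c → v = l[i] ∨ v = q)
    (hq : (∃ m, ∃ hm : m < i, l[m]'(by omega) = q) ∨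
      (∃ n₀ : HV, ∀ w, hvGraph.Adj q w → 0 ≤ lev w → lev w ≤ 2 * (2 : ℕ) - 1 → xi l[0] < xi w → w ≠ l[i] → w = n₀)) :
    IsRenewalIdx l i := by
  obtain ⟨hne, hbr⟩ := hB
  have hhead : l.head hne = l[0] := List.head_eq_getElem hne
  refine ⟨hi0, hi, fun j hj => ?_, ?_⟩
  · rw [mem_range] at hj
    rw [xiAt_eq_xi_getElem (by omega), xiAt_eq_xi_getElem (by omega), hci]
    rcases Nat.lt_succ_iff_lt_or_eq.1 hj with h | rfl
    · exact hbef j h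
    · exact hci.le
  · suffices H : ∀ n : ℕ, ∀ hn : i + 1 + n < l.length, c + 1 ≤ xi l[i + 1 + n] by
      intro j hj hij
      rw [mem_range] at hj
      obtain ⟨n, rfl⟩ : ∃ n, j = i + 1 + n := ⟨j - (i + 1), by omega⟩
      rw [xiAt_eq_xi_getElem (by omega), xiAt_eq_xi_getElem hj, hci]
      have := H n hj
      omega
    intro n
    induction n with
    | zero => intro hn; simp only [add_zero, hnext, le_refl]
    | succ n ih =>
      intro hn
      have hprev := ih (by omega)
      have hadj : hvGraph.Adj l[i + 1 + n] l[i + 1 + (n + 1)] := by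
        have := List.isChain_iff_getElem.1 hc (i + 1 + n) (by omega)
        simpa only [add_assoc] using this
      have hstep := xi_adj hadj
      have hneq : xi l[i + 1 + (n + 1)] ≠ c := by
        intro heq
        have hlv := hin _ (List.getElem_mem (by omega : i + 1 + (n + 1) < l.length))
        rcases hcol _ hlv.1 hlv.2 heq with h | h
        · have := (hnd.getElem_inj_iff).1 h
          omega
        · rcases hq with ⟨m, hm, hmq⟩ | ⟨n₀, hn₀⟩
          · rw [← hmq] at h
            have := (hnd.getElem_inj_iff).1 h
            omega
          · by_cases hlast : i + 1 + (n + 1) + 1 < l.length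
            · -- two distinct admissible neighbours of the dead end `q`
              have h1 : hvGraph.Adj q l[i + 1 + n] := by rw [← h]; exact hadj.symm
              have h2 : hvGraph.Adj q l[i + 1 + (n + 1) + 1] := by
                rw [← h]; exact List.isChain_iff_getElem.1 hc (i + 1 + (n + 1)) hlast
              have hl1 := hin _ (List.getElem_mem (by omega : i + 1 + n < l.length))
              have hl2 := hin _ (List.getElem_mem hlast)
              have hx1 := (hbr _ (getElem_mem_tail (by omega) (by omega : i + 1 + n < l.length))).1
              have hx2 := (hbr _ (getElem_mem_tail (by omega) hlast)).1
              rw [hhead] at hx1 hx2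
              have hn1 : l[i + 1 + n] ≠ l[i] := fun hh => by have := (hnd.getElem_inj_iff).1 hh; omega
              have hn2 : l[i + 1 + (n + 1) + 1] ≠ l[i] := fun hh => by have := (hnd.getElem_inj_iff).1 hh; omega
              have e1 := hn₀ _ h1 hl1.1 hl1.2 hx1 hn1
              have e2 := hn₀ _ h2 hl2.1 hl2.2 hx2 hn2
              have := (hnd.getElem_inj_iff).1 (e1.trans e2.symm)
              omega
            · -- `q` is the last vertex: the bridge condition fails for `l[i+1]`
              have hlen : l.length - 1 = i + 1 + (n + 1) := by omega
              have hx := (hbr _ (getElem_mem_tail (by omega) (by omega : i + 1 < l.length))).2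
              rw [List.getLast_eq_getElem] at hx
              simp only [hlen] at hx
              rw [heq, hnext] at hx
              omega
      omega

/-! ### §3 The six irreducible bridges of `S₂` -/

/-- Neighbours of `(0,0,false)` (plumbing). [cite: DuminilCopinSmirnov2012, §3 (Fig. 3)] -/
theorem adj_00f {v : HV} : hvGraph.Adj (0, 0, false) v ↔ v = (0, 0, true) ∨ v = (-1, 0, true) ∨ v = (0, -1, true) := by
  rw [adj_false_iff]; norm_num
/-- Neighbours of `(0,0,true)` (plumbing). [cite: DuminilCopinSmirnov2012, §3 (Fig. 3)] -/
theorem adj_00t {v : HV} : hvGraph.Adj (0, 0, true) v ↔ v = (0, 0, false) ∨ v = (1, 0, false) ∨ v = (0, 1, false) := by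
  rw [adj_true_iff]; norm_num
/-- Neighbours of `(0,1,false)` (plumbing). [cite: DuminilCopinSmirnov2012, §3 (Fig. 3)] -/
theorem adj_01f {v : HV} : hvGraph.Adj (0, 1, false) v ↔ v = (0, 1, true) ∨ v = (-1, 1, true) ∨ v = (0, 0, true) := by
  rw [adj_false_iff]; norm_num
/-- Neighbours of `(0,1,true)` (plumbing). [cite: DuminilCopinSmirnov2012, §3 (Fig. 3)] -/
theorem adj_01t {v : HV} : hvGraph.Adj (0, 1, true) v ↔ v = (0, 1, false) ∨ v = (1, 1, false) ∨ v = (0, 2, false) := by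
  rw [adj_true_iff]; norm_num
/-- Neighbours of `(1,0,false)` (plumbing). [cite: DuminilCopinSmirnov2012, §3 (Fig. 3)] -/
theorem adj_10f {v : HV} : hvGraph.Adj (1, 0, false) v ↔ v = (1, 0, true) ∨ v = (0, 0, true) ∨ v = (1, -1, true) := by
  rw [adj_false_iff]; norm_num
/-- Neighbours of `(1,0,true)` (plumbing). [cite: DuminilCopinSmirnov2012, §3 (Fig. 3)] -/
theorem adj_10t {v : HV} : hvGraph.Adj (1, 0, true) v ↔ v = (1, 0, false) ∨ v = (2, 0, false) ∨ v = (1, 1, false) := by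
  rw [adj_true_iff]; norm_num
/-- Neighbours of `(1,1,false)` (plumbing). [cite: DuminilCopinSmirnov2012, §3 (Fig. 3)] -/
theorem adj_11f {v : HV} : hvGraph.Adj (1, 1, false) v ↔ v = (1, 1, true) ∨ v = (0, 1, true) ∨ v = (1, 0, true) := by
  rw [adj_false_iff]; norm_num

/-- `0 → 1`: one right slant along the bottom rail. [cite: DuminilCopinHammond2013, §2.2 (irreducible bridges); lane «pcv-sawmu» a-p2 g24] -/
def irr01 : List HV := [(0, 0, false), (0, 0, true)]
/-- `0 → 2`: bottom slant then the rung upwards. [cite: DuminilCopinHammond2013, §2.2 (irreducible bridges); lane «pcv-sawmu» a-p2 g24] -/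
def irr02 : List HV := [(0, 0, false), (0, 0, true), (0, 1, false)]
/-- `1 → 0`: one right slant along the bottom rail. [cite: DuminilCopinHammond2013, §2.2 (irreducible bridges); lane «pcv-sawmu» a-p2 g24] -/
def irr10 : List HV := [(0, 0, true), (1, 0, false)]
/-- `2 → 3`: one right slant along the top rail, ending ON the surface (the only surface contact of the kernel). [cite: DuminilCopinHammond2013, §2.2 (irreducible bridges); lane «pcv-sawmu» a-p2 g24] -/
def irr23 : List HV := [(0, 1, false), (0, 1, true)]
/-- `3 → 2`: one right slant along the top rail. [cite: DuminilCopinHammond2013, §2.2 (irreducible bridges); lane «pcv-sawmu» a-p2 g24] -/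
def irr32 : List HV := [(0, 1, true), (1, 1, false)]
/-- `3 → 1`: top slant then the rung downwards. [cite: DuminilCopinHammond2013, §2.2 (irreducible bridges); lane «pcv-sawmu» a-p2 g24] -/
def irr31 : List HV := [(0, 1, true), (1, 1, false), (1, 0, true)]

/-- An irreducible bridge has no renewal index (plumbing). [cite: DuminilCopinHammond2013, §2.2] -/
theorem not_isRenewalIdx_of_npieces {l : List HV} (h : npieces l = 1) (i : ℕ) : ¬ IsRenewalIdx l i := by
  intro hi
  have hmem : i ∈ renIdxs l := by
    rw [renIdxs, mem_filter, mem_range]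
    exact ⟨by have := hi.2.1; omega, hi⟩
  rw [npieces, Nat.add_eq_right, Finset.card_eq_zero] at h
  rw [h] at hmem
  simp at hmem

/-- ★★ **CLASSIFICATION.**  Every irreducible standard horizontal bridge of the width-two strip `S₂` is one of the six lists `irr01`, `irr02`,
`irr10`, `irr23`, `irr32`, `irr31` (with the matching levels): a bridge of `S₂` reaching the column `ξ₀ + 2` has a renewal index, because every
column of `S₂` holds only two vertices (no-return lemma). [cite: DuminilCopinHammond2013, §2.2 (irreducible bridges); DuminilCopinSmirnov2012, §3 (Fig. 3: the strip S_T); lane «pcv-sawmu» a-p2 g24 — own result] -/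
theorem mem_HBk_two_one {N : ℕ} {a b : ℤ} {l : List HV} (hl : l ∈ HBk 2 N 1 a b) :
    (l = irr01 ∧ a = 0 ∧ b = 1) ∨ (l = irr02 ∧ a = 0 ∧ b = 2) ∨ (l = irr10 ∧ a = 1 ∧ b = 0) ∨
      (l = irr23 ∧ a = 2 ∧ b = 3) ∨ (l = irr32 ∧ a = 3 ∧ b = 2) ∨ (l = irr31 ∧ a = 3 ∧ b = 1) := by
  rw [HBk, mem_filter, mem_hBridgesN_iff] at hl
  obtain ⟨⟨hc, hnd, -, ⟨v, hv, hv0⟩, hin, hB⟩, h2, hnp, ha, hb⟩ := hl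
  have hirr := not_isRenewalIdx_of_npieces hnp
  have hB' := hB
  obtain ⟨hne, hbr⟩ := hB'
  rcases l with _ | ⟨v0, _ | ⟨v1, rest⟩⟩
  · simp at h2
  · simp at h2
  simp only [List.head?_cons, Option.some.injEq] at hv
  subst hv
  obtain ⟨x0, j0, c0⟩ := v0
  simp only at hv0
  subst hv0
  have hlv0 := hin _ List.mem_cons_self
  simp only [List.head_cons, List.tail_cons] at hbr
  simp only [hdLev, ltLev, List.head?_cons, Option.getD_some] at ha hb
  have hj0 : j0 = 0 ∨ j0 = 1 := by cases c0 <;> simp [bit] at hlv0 <;> omega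
  obtain ⟨h01, hc1⟩ := List.isChain_cons_cons.1 hc
  rcases hj0 with rfl | rfl <;> cases c0
  · -- head `(0,0,false)`, level 0, column 0
    rcases adj_00f.1 h01 with rfl | rfl | rfl
    rotate_left
    · exact absurd (hbr _ List.mem_cons_self).1 (by norm_num [xi, bit])
    · exact absurd (hbr _ List.mem_cons_self).1 (by norm_num [xi, bit])
    rcases rest with _ | ⟨v2, rest'⟩
    · refine Or.inl ⟨rfl, ?_, ?_⟩
      · simpa [bit] using ha.symm
      · simpa [bit] using hb.symm
    obtain ⟨h12, hc2⟩ := List.isChain_cons_cons.1 hc1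
    rcases adj_00t.1 h12 with rfl | rfl | rfl
    · simp at hnd
    · -- `(1,0,false)`: column 1 = {l[1], (0,1,false)} with (0,1,false) a dead end ⇒ index 1 would be a renewal index
      refine absurd (isRenewalIdx_of_column hc hnd hB hin one_pos (by simp) (c := 1) (by show xi (0, 0, true) = 1; norm_num [xi, bit])
        (fun j hj => ?_) (by show xi (1, 0, false) = 1 + 1; norm_num [xi, bit]) (0, 1, false) (fun w h0 h3 hw => ?_)
        (Or.inr ⟨(0, 1, true), fun w hw h0 h3 hx hne1 => ?_⟩)) (hirr 1)
      · interval_cases j; show xi (0, 0, false) ≤ 1; norm_num [xi, bit]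
      · rcases eq_of_xi_eq_odd h0 h3 0 (by simpa using hw) with rfl | rfl
        exacts [Or.inl rfl, Or.inr rfl]
      · rcases adj_01f.1 hw with rfl | rfl | rfl
        · rfl
        · simp only [List.getElem_cons_zero] at hx; norm_num [xi, bit] at hx
        · exact absurd rfl hne1
    · rcases rest' with _ | ⟨v3, rest''⟩
      · refine Or.inr (Or.inl ⟨rfl, ?_, ?_⟩)
        · simpa [bit] using ha.symm
        · simpa [bit] using hb.symm
      obtain ⟨h23, hc3⟩ := List.isChain_cons_cons.1 hc2
      rcases adj_01f.1 h23 with rfl | rfl | rfl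
      · -- `(0,1,true)`: column 1 = {l[1], l[2]} both used ⇒ index 2 would be a renewal index
        refine absurd (isRenewalIdx_of_column hc hnd hB hin two_pos (by simp) (c := 1) (by show xi (0, 1, false) = 1; norm_num [xi, bit])
          (fun j hj => ?_) (by show xi (0, 1, true) = 1 + 1; norm_num [xi, bit]) (0, 0, true) (fun w h0 h3 hw => ?_)
          (Or.inl ⟨1, one_lt_two, rfl⟩)) (hirr 2)
        · interval_cases j
          · show xi (0, 0, false) ≤ 1; norm_num [xi, bit]
          · show xi (0, 0, true) ≤ 1; norm_num [xi, bit]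
        · rcases eq_of_xi_eq_odd h0 h3 0 (by simpa using hw) with rfl | rfl
          exacts [Or.inr rfl, Or.inl rfl]
      · exact absurd (hbr _ (List.mem_cons_of_mem _ (List.mem_cons_of_mem _ List.mem_cons_self))).1 (by norm_num [xi, bit])
      · simp at hnd
  · -- head `(0,0,true)`, level 1, column 1
    rcases adj_00t.1 h01 with rfl | rfl | rfl
    · exact absurd (hbr _ List.mem_cons_self).1 (by norm_num [xi, bit])
    rotate_left
    · exact absurd (hbr _ List.mem_cons_self).1 (by norm_num [xi, bit])
    rcases rest with _ | ⟨v2, rest'⟩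
    · refine Or.inr (Or.inr (Or.inl ⟨rfl, ?_, ?_⟩))
      · simpa [bit] using ha.symm
      · simpa [bit] using hb.symm
    obtain ⟨h12, hc2⟩ := List.isChain_cons_cons.1 hc1
    rcases adj_10f.1 h12 with rfl | rfl | rfl
    · -- `(1,0,true)`: column 2 = {l[1], (0,1,true)} with (0,1,true) a dead end
      refine absurd (isRenewalIdx_of_column hc hnd hB hin one_pos (by simp) (c := 2) (by show xi (1, 0, false) = 2; norm_num [xi, bit])
        (fun j hj => ?_) (by show xi (1, 0, true) = 2 + 1; norm_num [xi, bit]) (0, 1, true) (fun w h0 h3 hw => ?_)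
        (Or.inr ⟨(1, 1, false), fun w hw h0 h3 hx hne1 => ?_⟩)) (hirr 1)
      · interval_cases j; show xi (0, 0, true) ≤ 2; norm_num [xi, bit]
      · rcases eq_of_xi_eq_even h0 h3 1 (by simpa using hw) with rfl | rfl
        exacts [Or.inl rfl, Or.inr rfl]
      · rcases adj_01t.1 hw with rfl | rfl | rfl
        · simp only [List.getElem_cons_zero] at hx; norm_num [xi, bit] at hx
        · rfl
        · norm_num [bit] at h3
    · simp at hnd
    · exact absurd (hin _ (List.mem_cons_of_mem _ (List.mem_cons_of_mem _ List.mem_cons_self))).1 (by norm_num [bit])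
  · -- head `(0,1,false)`, level 2, column 1
    rcases adj_01f.1 h01 with rfl | rfl | rfl
    rotate_left
    · exact absurd (hbr _ List.mem_cons_self).1 (by norm_num [xi, bit])
    · exact absurd (hbr _ List.mem_cons_self).1 (by norm_num [xi, bit])
    rcases rest with _ | ⟨v2, rest'⟩
    · refine Or.inr (Or.inr (Or.inr (Or.inl ⟨rfl, ?_, ?_⟩)))
      · simpa [bit] using ha.symm
      · simpa [bit] using hb.symm
    obtain ⟨h12, hc2⟩ := List.isChain_cons_cons.1 hc1
    rcases adj_01t.1 h12 with rfl | rfl | rfl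
    · simp at hnd
    · -- `(1,1,false)`: column 2 = {l[1], (1,0,false)} with (1,0,false) a dead end
      refine absurd (isRenewalIdx_of_column hc hnd hB hin one_pos (by simp) (c := 2) (by show xi (0, 1, true) = 2; norm_num [xi, bit])
        (fun j hj => ?_) (by show xi (1, 1, false) = 2 + 1; norm_num [xi, bit]) (1, 0, false) (fun w h0 h3 hw => ?_)
        (Or.inr ⟨(1, 0, true), fun w hw h0 h3 hx hne1 => ?_⟩)) (hirr 1)
      · interval_cases j; show xi (0, 1, false) ≤ 2; norm_num [xi, bit]
      · rcases eq_of_xi_eq_even h0 h3 1 (by simpa using hw) with rfl | rfl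
        exacts [Or.inr rfl, Or.inl rfl]
      · rcases adj_10f.1 hw with rfl | rfl | rfl
        · rfl
        · simp only [List.getElem_cons_zero] at hx; norm_num [xi, bit] at hx
        · norm_num [bit] at h0
    · exact absurd (hin _ (List.mem_cons_of_mem _ (List.mem_cons_of_mem _ List.mem_cons_self))).2 (by norm_num [bit])
  · -- head `(0,1,true)`, level 3, column 2
    rcases adj_01t.1 h01 with rfl | rfl | rfl
    · exact absurd (hbr _ List.mem_cons_self).1 (by norm_num [xi, bit])
    rotate_left
    · exact absurd (hin _ (List.mem_cons_of_mem _ List.mem_cons_self)).2 (by norm_num [bit])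
    rcases rest with _ | ⟨v2, rest'⟩
    · refine Or.inr (Or.inr (Or.inr (Or.inr (Or.inl ⟨rfl, ?_, ?_⟩))))
      · simpa [bit] using ha.symm
      · simpa [bit] using hb.symm
    obtain ⟨h12, hc2⟩ := List.isChain_cons_cons.1 hc1
    rcases adj_11f.1 h12 with rfl | rfl | rfl
    · -- `(1,1,true)`: column 3 = {l[1], (1,0,true)} with (1,0,true) a dead end
      refine absurd (isRenewalIdx_of_column hc hnd hB hin one_pos (by simp) (c := 3) (by show xi (1, 1, false) = 3; norm_num [xi, bit])
        (fun j hj => ?_) (by show xi (1, 1, true) = 3 + 1; norm_num [xi, bit]) (1, 0, true) (fun w h0 h3 hw => ?_)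
        (Or.inr ⟨(2, 0, false), fun w hw h0 h3 hx hne1 => ?_⟩)) (hirr 1)
      · interval_cases j; show xi (0, 1, true) ≤ 3; norm_num [xi, bit]
      · rcases eq_of_xi_eq_odd h0 h3 1 (by simpa using hw) with rfl | rfl
        exacts [Or.inr rfl, Or.inl rfl]
      · rcases adj_10t.1 hw with rfl | rfl | rfl
        · simp only [List.getElem_cons_zero] at hx; norm_num [xi, bit] at hx
        · rfl
        · exact absurd rfl hne1
    · simp at hnd
    · rcases rest' with _ | ⟨v3, rest''⟩
      · refine Or.inr (Or.inr (Or.inr (Or.inr (Or.inr ⟨rfl, ?_, ?_⟩))))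
        · simpa [bit] using ha.symm
        · simpa [bit] using hb.symm
      obtain ⟨h23, hc3⟩ := List.isChain_cons_cons.1 hc2
      rcases adj_10t.1 h23 with rfl | rfl | rfl
      · exact absurd (hbr _ (List.mem_cons_of_mem _ (List.mem_cons_of_mem _ List.mem_cons_self))).1 (by norm_num [xi, bit])
      · -- `(2,0,false)`: column 3 = {l[2], l[1]} both used ⇒ index 2 would be a renewal index
        refine absurd (isRenewalIdx_of_column hc hnd hB hin two_pos (by simp) (c := 3) (by show xi (1, 0, true) = 3; norm_num [xi, bit])
          (fun j hj => ?_) (by show xi (2, 0, false) = 3 + 1; norm_num [xi, bit]) (1, 1, false) (fun w h0 h3 hw => ?_)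
          (Or.inl ⟨1, one_lt_two, rfl⟩)) (hirr 2)
        · interval_cases j
          · show xi (0, 1, true) ≤ 3; norm_num [xi, bit]
          · show xi (1, 1, false) ≤ 3; norm_num [xi, bit]
        · rcases eq_of_xi_eq_odd h0 h3 1 (by simpa using hw) with rfl | rfl
          exacts [Or.inl rfl, Or.inr rfl]
      · simp at hnd

/-! ### §4 The six lists ARE irreducible standard bridges; the level classes of `S₂` as explicit finsets -/

/-- The four one-step lists are irreducible standard bridges (`N ≥ 1`). [cite: DuminilCopinHammond2013, §2.2; lane «pcv-sawmu» a-p2 g24] -/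
theorem irr_pair_mem {N : ℕ} (hN : 1 ≤ N) :
    irr01 ∈ HBk 2 N 1 0 1 ∧ irr10 ∈ HBk 2 N 1 1 0 ∧ irr23 ∈ HBk 2 N 1 2 3 ∧ irr32 ∈ HBk 2 N 1 3 2 := by
  refine ⟨?_, ?_, ?_, ?_⟩
  · simpa [irr01, bit] using pair_mem_HBk (T := 2) hN (adj_00f.2 (Or.inl rfl)) rfl (by norm_num [xi, bit])
      (by norm_num [bit]) (by norm_num [bit])
  · simpa [irr10, bit] using pair_mem_HBk (T := 2) hN (adj_00t.2 (Or.inr (Or.inl rfl))) rfl (by norm_num [xi, bit])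
      (by norm_num [bit]) (by norm_num [bit])
  · simpa [irr23, bit] using pair_mem_HBk (T := 2) hN (adj_01f.2 (Or.inl rfl)) rfl (by norm_num [xi, bit])
      (by norm_num [bit]) (by norm_num [bit])
  · simpa [irr32, bit] using pair_mem_HBk (T := 2) hN (adj_01t.2 (Or.inr (Or.inl rfl))) rfl (by norm_num [xi, bit])
      (by norm_num [bit]) (by norm_num [bit])

/-- The two rung lists are irreducible standard bridges (`N ≥ 2`). [cite: DuminilCopinHammond2013, §2.2; lane «pcv-sawmu» a-p2 g24] -/
theorem irr_triple_mem {N : ℕ} (hN : 2 ≤ N) : irr02 ∈ HBk 2 N 1 0 2 ∧ irr31 ∈ HBk 2 N 1 3 1 := by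
  refine ⟨?_, ?_⟩
  · simpa [irr02, bit] using triple_mem_HBk (T := 2) hN (adj_00f.2 (Or.inl rfl)) (adj_00t.2 (Or.inr (Or.inr rfl))) rfl
      (by norm_num [xi, bit]) (by norm_num [xi, bit]) (by norm_num [bit]) (by norm_num [bit]) (by norm_num [bit]) (by norm_num [bit])
  · simpa [irr31, bit] using triple_mem_HBk (T := 2) hN (adj_01t.2 (Or.inr (Or.inl rfl))) (adj_11f.2 (Or.inr (Or.inr rfl))) rfl
      (by norm_num [xi, bit]) (by norm_num [xi, bit]) (by norm_num [bit]) (by norm_num [bit]) (by norm_num [bit]) (by norm_num [bit])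

/-- The lengths of the six lists (plumbing). [cite: DuminilCopinHammond2013, §2.2; lane plumbing] -/
theorem length_irr : irr01.length = 2 ∧ irr10.length = 2 ∧ irr23.length = 2 ∧ irr32.length = 2 ∧ irr02.length = 3 ∧ irr31.length = 3 := by
  simp [irr01, irr10, irr23, irr32, irr02, irr31]

/-- A member of `HBk T N k a b` has at most `N + 1` vertices (plumbing). [cite: DuminilCopinHammond2013, §2.2; lane plumbing] -/
theorem length_le_of_mem_HBk {T N k : ℕ} {a b : ℤ} {l : List HV} (hl : l ∈ HBk T N k a b) : l.length ≤ N + 1 := by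
  rw [HBk, mem_filter, mem_hBridgesN_iff] at hl
  exact hl.1.2.2.1

/-- ★ The one-step classes: `HBk 2 N 1 0 1 = {irr01}`, `1 0 = {irr10}`, `2 3 = {irr23}`, `3 2 = {irr32}` for `N ≥ 1`.
[cite: DuminilCopinHammond2013, §2.2; lane «pcv-sawmu» a-p2 g24] -/
theorem HBk_two_pair {N : ℕ} (hN : 1 ≤ N) :
    HBk 2 N 1 0 1 = {irr01} ∧ HBk 2 N 1 1 0 = {irr10} ∧ HBk 2 N 1 2 3 = {irr23} ∧ HBk 2 N 1 3 2 = {irr32} := by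
  obtain ⟨h1, h2, h3, h4⟩ := irr_pair_mem hN
  refine ⟨?_, ?_, ?_, ?_⟩ <;> ext l <;> rw [mem_singleton] <;> constructor
  · intro hl; rcases mem_HBk_two_one hl with h | h | h | h | h | h <;> [exact h.1; norm_num at h; norm_num at h; norm_num at h; norm_num at h; norm_num at h]
  · rintro rfl; exact h1
  · intro hl; rcases mem_HBk_two_one hl with h | h | h | h | h | h <;> [norm_num at h; norm_num at h; exact h.1; norm_num at h; norm_num at h; norm_num at h]
  · rintro rfl; exact h2
  · intro hl; rcases mem_HBk_two_one hl with h | h | h | h | h | h <;> [norm_num at h; norm_num at h; norm_num at h; exact h.1; norm_num at h; norm_num at h]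
  · rintro rfl; exact h3
  · intro hl; rcases mem_HBk_two_one hl with h | h | h | h | h | h <;> [norm_num at h; norm_num at h; norm_num at h; norm_num at h; exact h.1; norm_num at h]
  · rintro rfl; exact h4

/-- ★ The rung classes: `HBk 2 N 1 0 2 = {irr02}`, `3 1 = {irr31}` for `N ≥ 2`. [cite: DuminilCopinHammond2013, §2.2; lane «pcv-sawmu» a-p2 g24] -/
theorem HBk_two_triple {N : ℕ} (hN : 2 ≤ N) : HBk 2 N 1 0 2 = {irr02} ∧ HBk 2 N 1 3 1 = {irr31} := by
  obtain ⟨h1, h2⟩ := irr_triple_mem hN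
  refine ⟨?_, ?_⟩ <;> ext l <;> rw [mem_singleton] <;> constructor
  · intro hl; rcases mem_HBk_two_one hl with h | h | h | h | h | h <;> [norm_num at h; exact h.1; norm_num at h; norm_num at h; norm_num at h; norm_num at h]
  · rintro rfl; exact h1
  · intro hl; rcases mem_HBk_two_one hl with h | h | h | h | h | h <;> [norm_num at h; norm_num at h; norm_num at h; norm_num at h; norm_num at h; exact h.1]
  · rintro rfl; exact h2

/-- The rung classes are empty below `N = 2` (three vertices do not fit). [cite: DuminilCopinHammond2013, §2.2; lane plumbing] -/
theorem HBk_two_triple_lt {N : ℕ} (hN : N < 2) : HBk 2 N 1 0 2 = ∅ ∧ HBk 2 N 1 3 1 = ∅ := by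
  refine ⟨?_, ?_⟩ <;> rw [Finset.eq_empty_iff_forall_notMem] <;> intro l hl <;> have hlen := length_le_of_mem_HBk hl <;>
    rcases mem_HBk_two_one hl with h | h | h | h | h | h <;>
    first | (norm_num at h; done) | (obtain ⟨rfl, -, -⟩ := h; simp [irr02, irr31] at hlen; omega)

/-- The other ten level classes are empty (all `N`). [cite: DuminilCopinHammond2013, §2.2; lane «pcv-sawmu» a-p2 g24] -/
theorem HBk_two_empty {N : ℕ} {a b : ℤ}
    (h : ¬ ((a = 0 ∧ b = 1) ∨ (a = 0 ∧ b = 2) ∨ (a = 1 ∧ b = 0) ∨ (a = 2 ∧ b = 3) ∨ (a = 3 ∧ b = 2) ∨ (a = 3 ∧ b = 1))) :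
    HBk 2 N 1 a b = ∅ := by
  rw [Finset.eq_empty_iff_forall_notMem]
  intro l hl
  rcases mem_HBk_two_one hl with ⟨-, hh⟩ | ⟨-, hh⟩ | ⟨-, hh⟩ | ⟨-, hh⟩ | ⟨-, hh⟩ | ⟨-, hh⟩
  · exact h (Or.inl hh)
  · exact h (Or.inr (Or.inl hh))
  · exact h (Or.inr (Or.inr (Or.inl hh)))
  · exact h (Or.inr (Or.inr (Or.inr (Or.inl hh))))
  · exact h (Or.inr (Or.inr (Or.inr (Or.inr (Or.inl hh)))))
  · exact h (Or.inr (Or.inr (Or.inr (Or.inr (Or.inr hh)))))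

/-- `HBk T 0 k a b = ∅`: at least two vertices do not fit (plumbing). [cite: DuminilCopinHammond2013, §2.2; lane plumbing] -/
theorem HBk_zero_eq_empty (T k : ℕ) (a b : ℤ) : HBk T 0 k a b = ∅ := by
  rw [Finset.eq_empty_iff_forall_notMem]
  intro l hl
  have h1 := length_le_of_mem_HBk hl
  rw [HBk, mem_filter] at hl
  have := hl.2.1
  omega

/-- The weights of the six lists (plumbing): `x`, `x`, `x·y`, `x`, `x²`, `x²`. [cite: DuminilCopinHammond2013, §2.2 (weights multiply); lane plumbing] -/
theorem wD_irr (y : ℝ) :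
    wD 2 y irr01 = hexCriticalFugacity ∧ wD 2 y irr10 = hexCriticalFugacity ∧ wD 2 y irr23 = hexCriticalFugacity * y ∧
      wD 2 y irr32 = hexCriticalFugacity ∧ wD 2 y irr02 = hexCriticalFugacity ^ 2 ∧ wD 2 y irr31 = hexCriticalFugacity ^ 2 := by
  simp [wD, irr01, irr10, irr23, irr32, irr02, irr31, topCnt, bit]

/-! ### §5 The kernel in closed form -/

/-- ★★ **The critical irreducible kernel of `S₂` in closed form**: with `x = x_c`,
`K(y) = (0,x,x²,0 | x,0,0,0 | 0,0,0,xy | 0,x²,x,0)` (rows = start level, columns = end level; the single `y` is the surface contact of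
`irr23`). [cite: DuminilCopinHammond2013, §2.2 (irreducible bridges); BeatonGuttmannJensen2012, §2 (the narrow-strip transfer matrix); lane «pcv-sawmu» a-p2 g24 — own result] -/
def kerTwo (y : ℝ) : Matrix (Fin (2 * 2)) (Fin (2 * 2)) ℝ :=
  Matrix.of ![![0, hexCriticalFugacity, hexCriticalFugacity ^ 2, 0], ![hexCriticalFugacity, 0, 0, 0],
    ![0, 0, 0, hexCriticalFugacity * y], ![0, hexCriticalFugacity ^ 2, hexCriticalFugacity, 0]]

/-- ★★ `Imat 2 N y = K(y)` for every truncation `N ≥ 2`: the truncated kernels of `S₂` are constant from `N = 2` on.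
[cite: DuminilCopinHammond2013, §2.2; lane «pcv-sawmu» a-p2 g24 — own result] -/
theorem Imat_two_eq {N : ℕ} (hN : 2 ≤ N) (y : ℝ) : Imat 2 N y = kerTwo y := by
  obtain ⟨h01, h10, h23, h32⟩ := HBk_two_pair (by omega : 1 ≤ N)
  obtain ⟨h02, h31⟩ := HBk_two_triple hN
  obtain ⟨w01, w10, w23, w32, w02, w31⟩ := wD_irr y
  ext a b
  fin_cases a <;> fin_cases b <;>
    simp [Imat, Dk, kerTwo, h01, h10, h23, h32, h02, h31, w01, w10, w23, w32, w02, w31, HBk_two_empty]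

/-- ★★ `Iinf 2 y = K(y)` (`y ≥ 0`): the irreducible kernel of the width-two strip is a POLYNOMIAL matrix — in particular all its contact and
length moments are finite at every `y`. [cite: DuminilCopinHammond2013, §2.2; lane «pcv-sawmu» a-p2 g24 — own result] -/
theorem Iinf_two_eq {y : ℝ} (hy : 0 ≤ y) : Iinf 2 y = kerTwo y := by
  ext a b
  have hconst : ∀ N, 2 ≤ N → Imat 2 N y a b = kerTwo y a b := fun N hN => by rw [Imat_two_eq hN]
  have hle : ∀ N, Imat 2 N y a b ≤ kerTwo y a b := fun N =>
    (Imat_mono_N (le_max_left N 2) hy a b).trans (hconst _ (le_max_right N 2)).le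
  have hbdd : BddAbove (Set.range fun N : ℕ => Imat 2 N y a b) := ⟨kerTwo y a b, by rintro _ ⟨N, rfl⟩; exact hle N⟩
  simp only [Iinf]
  refine le_antisymm (ciSup_le hle) ?_
  calc kerTwo y a b = Imat 2 2 y a b := (hconst 2 le_rfl).symm
    _ ≤ ⨆ N, Imat 2 N y a b := le_ciSup hbdd 2

/-! ### §6 The length grading of the kernel: `M(1)`, `M(2)`, nothing else; the first-moment matrix `M̄_len` -/

/-- A member of an irreducible class of `S₂` has one or two steps. [cite: DuminilCopinHammond2013, §2.2; lane «pcv-sawmu» a-p2 g24] -/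
theorem hlen_of_mem_HBk_two {N : ℕ} {a b : ℤ} {l : List HV} (hl : l ∈ HBk 2 N 1 a b) : hlen l = 1 ∨ hlen l = 2 := by
  rcases mem_HBk_two_one hl with ⟨rfl, -⟩ | ⟨rfl, -⟩ | ⟨rfl, -⟩ | ⟨rfl, -⟩ | ⟨rfl, -⟩ | ⟨rfl, -⟩ <;>
    simp [hlen, irr01, irr02, irr10, irr23, irr32, irr31]

/-- The one-step part `M(1)(y) = (0,x,0,0 | x,0,0,0 | 0,0,0,xy | 0,0,x,0)` of the kernel of `S₂`. [cite: DuminilCopinHammond2013, §2.2; lane «pcv-sawmu» a-p2 g24] -/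
def lenOneTwo (y : ℝ) : Matrix (Fin (2 * 2)) (Fin (2 * 2)) ℝ :=
  Matrix.of ![![0, hexCriticalFugacity, 0, 0], ![hexCriticalFugacity, 0, 0, 0], ![0, 0, 0, hexCriticalFugacity * y],
    ![0, 0, hexCriticalFugacity, 0]]

/-- The two-step part `M(2) = (0,0,x²,0 | 0,0,0,0 | 0,0,0,0 | 0,x²,0,0)` of the kernel of `S₂` (the two rungs; no contact). [cite: DuminilCopinHammond2013, §2.2; lane «pcv-sawmu» a-p2 g24] -/
def lenTwoTwo : Matrix (Fin (2 * 2)) (Fin (2 * 2)) ℝ :=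
  Matrix.of ![![0, 0, hexCriticalFugacity ^ 2, 0], ![0, 0, 0, 0], ![0, 0, 0, 0], ![0, hexCriticalFugacity ^ 2, 0, 0]]

/-- The first-LENGTH-moment matrix `M̄_len(y) = M(1) + 2M(2) = (0,x,2x²,0 | x,0,0,0 | 0,0,0,xy | 0,2x²,x,0)` of `S₂`. [cite: DuminilCopinHammond2013, §2.2; Feller1968, XIII.11 (mean recurrence time); lane «pcv-sawmu» a-p2 g24] -/
def lenMomTwo (y : ℝ) : Matrix (Fin (2 * 2)) (Fin (2 * 2)) ℝ :=
  Matrix.of ![![0, hexCriticalFugacity, 2 * hexCriticalFugacity ^ 2, 0], ![hexCriticalFugacity, 0, 0, 0],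
    ![0, 0, 0, hexCriticalFugacity * y], ![0, 2 * hexCriticalFugacity ^ 2, hexCriticalFugacity, 0]]

/-- ★★ **The length-graded kernel of `S₂`**: `LMM 2 n n y = M(1)(y)` for `n = 1`, `= M(2)` for `n = 2`, and `= 0` for every other `n` —
the length generating kernel `I₂(s) = M(1)s + M(2)s²` is a quadratic polynomial. [cite: DuminilCopinHammond2013, §2.2; lane «pcv-sawmu» a-p2 g24 — own result] -/
theorem LMM_two_eq (n : ℕ) (y : ℝ) : LMM 2 n (n : ℤ) y = if n = 1 then lenOneTwo y else if n = 2 then lenTwoTwo else 0 := by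
  obtain ⟨w01, w10, w23, w32, w02, w31⟩ := wD_irr y
  have hl : hlen irr01 = 1 ∧ hlen irr10 = 1 ∧ hlen irr23 = 1 ∧ hlen irr32 = 1 ∧ hlen irr02 = 2 ∧ hlen irr31 = 2 := by
    simp [hlen, irr01, irr02, irr10, irr23, irr32, irr31]
  obtain ⟨l01, l10, l23, l32, l02, l31⟩ := hl
  rcases n with _ | _ | _ | n
  · ext a b
    simp [LMM, LMs, LMset, HBk_zero_eq_empty]
  · obtain ⟨h01, h10, h23, h32⟩ := HBk_two_pair (N := 1) le_rfl
    obtain ⟨h02, h31⟩ := HBk_two_triple_lt (N := 1) one_lt_two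
    ext a b
    fin_cases a <;> fin_cases b <;>
      simp [LMM, LMs, LMset, lenOneTwo, h01, h10, h23, h32, h02, h31, HBk_two_empty, Finset.filter_singleton, l01, l10, l23, l32,
        w01, w10, w23, w32]
  · obtain ⟨h01, h10, h23, h32⟩ := HBk_two_pair (N := 2) one_le_two
    obtain ⟨h02, h31⟩ := HBk_two_triple (N := 2) le_rfl
    ext a b
    fin_cases a <;> fin_cases b <;>
      simp [LMM, LMs, LMset, lenTwoTwo, h01, h10, h23, h32, h02, h31, HBk_two_empty, Finset.filter_singleton, l01, l10, l23, l32,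
        l02, l31, w02, w31]
  · have hne : (n + 3 : ℕ) ≠ 1 := by omega
    have hne' : (n + 3 : ℕ) ≠ 2 := by omega
    simp only [hne, hne', if_false]
    ext a b
    simp only [LMM, LMs, Matrix.zero_apply]
    refine sum_eq_zero fun l hl => ?_
    exfalso
    rw [LMset, mem_filter] at hl
    rcases hlen_of_mem_HBk_two hl.1 with h | h <;> rw [h] at hl <;> have := hl.2 <;> push_cast at this <;> omega

/-- ★★ `Σ_n n·M(n)(y) = M̄_len(y)` entrywise for `S₂` (the series has two terms). [cite: Feller1968, XIII.11; DuminilCopinHammond2013, §2.2; lane «pcv-sawmu» a-p2 g24] -/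
theorem tsum_mul_LMM_two (y : ℝ) (a b : Fin (2 * 2)) : ∑' n : ℕ, (n : ℝ) * LMM 2 n (n : ℤ) y a b = lenMomTwo y a b := by
  rw [tsum_eq_sum (s := ({1, 2} : Finset ℕ))]
  · rw [Finset.sum_pair (by norm_num), LMM_two_eq, LMM_two_eq]
    simp only [if_true, show (2 : ℕ) ≠ 1 from by norm_num, if_false]
    fin_cases a <;> fin_cases b <;> simp [lenOneTwo, lenTwoTwo, lenMomTwo]
  · intro n hn
    rw [mem_insert, mem_singleton, not_or] at hn
    rw [LMM_two_eq]
    simp [hn.1, hn.2]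

/-- The first-moment matrix of the tree (`Matrix.of fun a b => Σ' n, n · LMM 2 n n y a b`) IS `M̄_len(y)` (plumbing form used by the density theorems).
[cite: Feller1968, XIII.11; lane plumbing] -/
theorem lengthMomentMatrix_two_eq (y : ℝ) :
    (Matrix.of fun a b : Fin (2 * 2) => ∑' n : ℕ, (n : ℝ) * LMM 2 n (n : ℤ) y a b) = lenMomTwo y := by
  ext a b
  rw [Matrix.of_apply]
  exact tsum_mul_LMM_two y a b

/-! ### §7 The Perron data of the critical kernel in closed form -/

/-- `2x⁴ − 4x² + 1 = 0`: the minimal polynomial of `x_c = 1/√(2+√2)` (plumbing). [cite: DuminilCopinSmirnov2012, Theorem 1 (x_c = 1/√(2+√2))] -/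
theorem xc_minpoly : 2 * hexCriticalFugacity ^ 4 - 4 * hexCriticalFugacity ^ 2 + 1 = 0 := by
  have h := xc_sq_eq_half
  have hr : Real.sqrt 2 ^ 2 = 2 := Real.sq_sqrt (by norm_num)
  linear_combination (2 * hexCriticalFugacity ^ 2 - 2 - Real.sqrt 2) * h + (1 / 2 : ℝ) * hr

/-- `7y₂ = 26 − 16x²` (plumbing form of `y₂ = (10 + 8√2)/7`). [cite: BeatonBousquetMelouDeGierDuminilCopinGuttmann2014, Corollary 8 (the thresholds y_T); lane (the tree's `stripYT_two`)] -/
theorem seven_mul_stripYT_two : 7 * stripYT 2 - 26 + 16 * hexCriticalFugacity ^ 2 = 0 := by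
  rw [stripYT_two, sqrt_two_eq]
  ring

/-- ★ **Right Perron vector** of `K(y₂)` (scaled to `u₃ = 7`): `u = (10x − 4x³, 2 + 2x², 26x − 16x³, 7)`. [cite: Seneta1973, §1.4 (the positive eigenvector); lane «pcv-sawmu» a-p2 g24] -/
def uTwo : Fin (2 * 2) → ℝ :=
  ![10 * hexCriticalFugacity - 4 * hexCriticalFugacity ^ 3, 2 + 2 * hexCriticalFugacity ^ 2,
    26 * hexCriticalFugacity - 16 * hexCriticalFugacity ^ 3, 7]

/-- ★ **Left Perron vector** of `K(y₂)` (scaled to `ℓ₃ = 1`): `ℓ = (x − 2x³, 1 − 2x², 2x − 3x³, 1)`. [cite: Seneta1973, §1.4; lane «pcv-sawmu» a-p2 g24] -/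
def ellTwo : Fin (2 * 2) → ℝ :=
  ![hexCriticalFugacity - 2 * hexCriticalFugacity ^ 3, 1 - 2 * hexCriticalFugacity ^ 2,
    2 * hexCriticalFugacity - 3 * hexCriticalFugacity ^ 3, 1]

/-- Numerical window for `x_c²`: `0.29 < x_c² < 0.30` (plumbing). [cite: DuminilCopinSmirnov2012, Theorem 1] -/
theorem xc_sq_bounds : 0.29 < hexCriticalFugacity ^ 2 ∧ hexCriticalFugacity ^ 2 < 0.30 := by
  rw [xc_sq_eq_half]
  have h1 : (1.41 : ℝ) < Real.sqrt 2 := by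
    rw [show (1.41 : ℝ) = Real.sqrt (1.41 ^ 2) by rw [Real.sqrt_sq (by norm_num)]]
    exact Real.sqrt_lt_sqrt (by norm_num) (by norm_num)
  have h2 : Real.sqrt 2 < 1.42 := by
    rw [show (1.42 : ℝ) = Real.sqrt (1.42 ^ 2) by rw [Real.sqrt_sq (by norm_num)]]
    exact Real.sqrt_lt_sqrt (by norm_num) (by norm_num)
  constructor <;> linarith

/-- `u > 0`. [cite: Seneta1973, §1.4; lane «pcv-sawmu» a-p2 g24] -/
theorem uTwo_pos : ∀ a, 0 < uTwo a := by
  have hx := hexCriticalFugacity_pos_lt_one.1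
  obtain ⟨h1, h2⟩ := xc_sq_bounds
  intro a
  fin_cases a <;> simp only [uTwo]
  · show 0 < 10 * hexCriticalFugacity - 4 * hexCriticalFugacity ^ 3
    nlinarith
  · show 0 < 2 + 2 * hexCriticalFugacity ^ 2
    positivity
  · show 0 < 26 * hexCriticalFugacity - 16 * hexCriticalFugacity ^ 3
    nlinarith
  · show (0 : ℝ) < 7
    norm_num

/-- `ℓ > 0`. [cite: Seneta1973, §1.4; lane «pcv-sawmu» a-p2 g24] -/
theorem ellTwo_pos : ∀ b, 0 < ellTwo b := by
  have hx := hexCriticalFugacity_pos_lt_one.1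
  obtain ⟨h1, h2⟩ := xc_sq_bounds
  intro b
  fin_cases b <;> simp only [ellTwo]
  · show 0 < hexCriticalFugacity - 2 * hexCriticalFugacity ^ 3
    nlinarith
  · show 0 < 1 - 2 * hexCriticalFugacity ^ 2
    nlinarith
  · show 0 < 2 * hexCriticalFugacity - 3 * hexCriticalFugacity ^ 3
    nlinarith
  · show (0 : ℝ) < 1
    norm_num

/-- ★★ `K(y₂) u = u` and `ℓ K(y₂) = ℓ`: the explicit vectors are right / left fixed vectors of the critical kernel (all identities reduce to
`2x⁴ − 4x² + 1 = 0` and `7y₂ = 26 − 16x²`). [cite: Seneta1973, §1.4, §6.2; lane «pcv-sawmu» a-p2 g24 — own computation] -/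
theorem kerTwo_fixed : kerTwo (stripYT 2) *ᵥ uTwo = uTwo ∧ ellTwo ᵥ* kerTwo (stripYT 2) = ellTwo := by
  have hP := xc_minpoly
  have hy := seven_mul_stripYT_two
  constructor
  · ext a
    fin_cases a <;> simp [kerTwo, uTwo, Matrix.mulVec, dotProduct, Fin.sum_univ_four]
    · linear_combination (-8 * hexCriticalFugacity) * hP
    · linear_combination (-2 : ℝ) * hP
    · linear_combination hexCriticalFugacity * hy
    · linear_combination (-7 : ℝ) * hP
  · ext b
    fin_cases b <;> simp [kerTwo, ellTwo, Matrix.vecMul, dotProduct, Fin.sum_univ_four]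
    · ring
    · linear_combination (-1 : ℝ) * hP
    · linear_combination (-hexCriticalFugacity) * hP
    · linear_combination ((2 / 7) * hexCriticalFugacity ^ 2 - (3 / 7) * hexCriticalFugacity ^ 4) * hy +
        (-1 + (24 / 7) * hexCriticalFugacity ^ 2) * hP

/-- ★★ The explicit vectors are positive fixed vectors of the tree's critical kernel `Iinf 2 y₂`. [cite: Seneta1973, §6.2; lane «pcv-sawmu» a-p2 g24] -/
theorem Iinf_two_fixed : Iinf 2 (stripYT 2) *ᵥ uTwo = uTwo ∧ ellTwo ᵥ* Iinf 2 (stripYT 2) = ellTwo := by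
  rw [Iinf_two_eq (stripYT_pos (by norm_num)).le]
  exact kerTwo_fixed

/-- ★ The three scalars of the Perron data: `⟨ℓ, u⟩ = 22 − 20x²`, `⟨ℓ, M̄_len(y₂) u⟩ = 20 − 8x²` (both for the scalings above).
[cite: Feller1968, XIII.11; lane «pcv-sawmu» a-p2 g24 — own computation] -/
theorem perron_scalars_two :
    ellTwo ⬝ᵥ uTwo = 22 - 20 * hexCriticalFugacity ^ 2 ∧
      ellTwo ⬝ᵥ (lenMomTwo (stripYT 2) *ᵥ uTwo) = 20 - 8 * hexCriticalFugacity ^ 2 := by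
  have hP := xc_minpoly
  have hy := seven_mul_stripYT_two
  constructor
  · simp [ellTwo, uTwo, dotProduct, Fin.sum_univ_four]
    linear_combination (-13 + 28 * hexCriticalFugacity ^ 2) * hP
  · simp [ellTwo, uTwo, lenMomTwo, Matrix.mulVec, dotProduct, Fin.sum_univ_four]
    linear_combination (2 * hexCriticalFugacity ^ 2 - 3 * hexCriticalFugacity ^ 4) * hy +
      (-20 + 22 * hexCriticalFugacity ^ 2 + 32 * hexCriticalFugacity ^ 4) * hP

/-! ### §7b The contact grading of the kernel: one entry; the contact-moment scalar `⟨ℓ, C̄_M u⟩ = 7` -/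

/-- Members of `LMset 2 n n` exist only for `n ∈ {1, 2}` (plumbing). [cite: DuminilCopinHammond2013, §2.2; lane plumbing] -/
theorem LMset_two_eq_empty {n : ℕ} (h1 : n ≠ 1) (h2 : n ≠ 2) (c d : ℤ) : LMset 2 n (n : ℤ) c d = ∅ := by
  rw [Finset.eq_empty_iff_forall_notMem]
  intro l hl
  rw [LMset, mem_filter] at hl
  rcases hlen_of_mem_HBk_two hl.1 with h | h <;> rw [h] at hl <;> have := hl.2 <;> omega

/-- Surface contacts of the six tails (plumbing): only `irr23` touches the surface. [cite: BeatonBousquetMelouDeGierDuminilCopinGuttmann2014, §3.2 (contacts); lane plumbing] -/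
theorem topCnt_tail_irr : topCnt 2 irr01.tail = 0 ∧ topCnt 2 irr10.tail = 0 ∧ topCnt 2 irr23.tail = 1 ∧ topCnt 2 irr32.tail = 0 ∧
    topCnt 2 irr02.tail = 0 ∧ topCnt 2 irr31.tail = 0 := by
  simp [irr01, irr10, irr23, irr32, irr02, irr31, topCnt, bit]

/-- The contact-weighted irreducible mass `C̄_M(y) = (0 … ; … ; 0,0,0,xy ; …)`: a single entry `(2,3)`. [cite: BeatonBousquetMelouDeGierDuminilCopinGuttmann2014, §3.2; lane «pcv-sawmu» a-p2 g24] -/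
def contactMomTwo (y : ℝ) : Matrix (Fin (2 * 2)) (Fin (2 * 2)) ℝ :=
  Matrix.of ![![0, 0, 0, 0], ![0, 0, 0, 0], ![0, 0, 0, hexCriticalFugacity * y], ![0, 0, 0, 0]]

/-- ★★ `Σ_n Σ_{irreducible, n steps, c → d} #top · wD = C̄_M(y)_{cd}` for `S₂`: the contact-weighted irreducible mass of the width-two strip is the
single entry `x·y` at `(2, 3)`. [cite: BeatonBousquetMelouDeGierDuminilCopinGuttmann2014, §3.2; DuminilCopinHammond2013, §2.2; lane «pcv-sawmu» a-p2 g24 — own result] -/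
theorem tsum_contactLMset_two (y : ℝ) (c d : Fin (2 * 2)) :
    ∑' n : ℕ, ∑ l ∈ LMset 2 n (n : ℤ) (c : ℕ) (d : ℕ), (topCnt 2 l.tail : ℝ) * wD 2 y l = contactMomTwo y c d := by
  obtain ⟨w01, w10, w23, w32, w02, w31⟩ := wD_irr y
  obtain ⟨t01, t10, t23, t32, t02, t31⟩ := topCnt_tail_irr
  have hl : hlen irr01 = 1 ∧ hlen irr10 = 1 ∧ hlen irr23 = 1 ∧ hlen irr32 = 1 ∧ hlen irr02 = 2 ∧ hlen irr31 = 2 := by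
    simp [hlen, irr01, irr02, irr10, irr23, irr32, irr31]
  obtain ⟨l01, l10, l23, l32, l02, l31⟩ := hl
  rw [tsum_eq_sum (s := ({1, 2} : Finset ℕ))]
  · rw [Finset.sum_pair (by norm_num)]
    obtain ⟨h01, h10, h23, h32⟩ := HBk_two_pair (N := 1) le_rfl
    obtain ⟨h02, h31⟩ := HBk_two_triple_lt (N := 1) one_lt_two
    obtain ⟨g01, g10, g23, g32⟩ := HBk_two_pair (N := 2) one_le_two
    obtain ⟨g02, g31⟩ := HBk_two_triple (N := 2) le_rfl
    fin_cases c <;> fin_cases d <;>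
      simp [LMset, contactMomTwo, h01, h10, h23, h32, h02, h31, g01, g10, g23, g32, g02, g31, HBk_two_empty, Finset.filter_singleton,
        l01, l10, l23, l32, l02, l31, w01, w10, w23, w32, w02, w31, t01, t10, t23, t32, t02, t31]
  · intro n hn
    rw [mem_insert, mem_singleton, not_or] at hn
    rw [LMset_two_eq_empty hn.1 hn.2, sum_empty]

/-- The contact-moment matrix of the tree IS `C̄_M(y)` (plumbing form used by the density theorems). [cite: BeatonBousquetMelouDeGierDuminilCopinGuttmann2014, §3.2; lane plumbing] -/
theorem contactMomentMatrix_two_eq (y : ℝ) :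
    (Matrix.of fun c d : Fin (2 * 2) => ∑' n : ℕ, ∑ l ∈ LMset 2 n (n : ℤ) (c : ℕ) (d : ℕ), (topCnt 2 l.tail : ℝ) * wD 2 y l) =
      contactMomTwo y := by
  ext c d
  rw [Matrix.of_apply]
  exact tsum_contactLMset_two y c d

/-- ★ `⟨ℓ, C̄_M(y₂) u⟩ = 7` and hence the CONSISTENCY IDENTITY `⟨ℓ, C̄_M(y₂) u⟩ · 4 = (3 − √2) · ⟨ℓ, M̄_len(y₂) u⟩`: the kernel of this file
reproduces the tree's pointwise contact density `θ₂ = (3 − √2)/4` (#687 `widthTwo_contacts_per_step_pointwise`, obtained there from the β-walk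
amplitudes `Λ₂`, `Λℓ₂` without any kernel) — two independent routes, one number. [cite: BeatonBousquetMelouDeGierDuminilCopinGuttmann2014, Corollary 8; Feller1968, XIII.11; lane «pcv-sawmu» a-p2 g24 — own computation] -/
theorem contact_scalar_two :
    ellTwo ⬝ᵥ (contactMomTwo (stripYT 2) *ᵥ uTwo) = 7 ∧
      ellTwo ⬝ᵥ (contactMomTwo (stripYT 2) *ᵥ uTwo) * 4 = (3 - Real.sqrt 2) * (ellTwo ⬝ᵥ (lenMomTwo (stripYT 2) *ᵥ uTwo)) := by
  have hP := xc_minpoly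
  have hy := seven_mul_stripYT_two
  have h7 : ellTwo ⬝ᵥ (contactMomTwo (stripYT 2) *ᵥ uTwo) = 7 := by
    simp [ellTwo, uTwo, contactMomTwo, Matrix.mulVec, dotProduct, Fin.sum_univ_four]
    linear_combination (2 * hexCriticalFugacity ^ 2 - 3 * hexCriticalFugacity ^ 4) * hy +
      (-7 + 24 * hexCriticalFugacity ^ 2) * hP
  refine ⟨h7, ?_⟩
  rw [h7, perron_scalars_two.2, sqrt_two_eq]
  linear_combination (8 : ℝ) * hP

/-! ### §7c `det(1 − K(y))` is the width-two transfer-matrix determinant -/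

/-- ★★ **`det(1 − K(y)) = W2.wdet x_c y = (1 − x²)(1 − x²y) − x⁶y`** for every `y`: the characteristic determinant of the renewal kernel of `S₂`
IS the determinant `det(I − M_x(y))` of the Beaton–Guttmann–Jensen transfer matrix of the tree's solved width-two strip (at `x = x_c`).  In
particular `K(y)` has the eigenvalue `1` exactly when `W2.wdet x_c y = 0`, i.e. (the tree's `W2.wdet_xc_eq`: `W(x_c, y) = κ₂(y₂ − y)`) at `y = y₂` only.
[cite: BeatonGuttmannJensen2012, §2 (the transfer matrix of the narrow strip); Seneta1973, §6.2 (the convergence parameter); lane «pcv-sawmu» a-p2 g24 — own result] -/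
theorem det_one_sub_kerTwo (y : ℝ) : (1 - kerTwo y).det = W2.wdet hexCriticalFugacity y := by
  rw [Matrix.det_succ_row_zero]
  simp [Fin.sum_univ_succ, Matrix.det_fin_three, kerTwo, W2.wdet, Matrix.submatrix_apply, Fin.succAbove, Matrix.one_apply]
  ring

end W2

/-! ### §8 ★★★ Renewal vertices per step of a long critical bridge of `S₂`: `ν₂ = √2 − 1/2` -/

open W2 in
/-- ★★★ **`ν₂ = √2 − 1/2`.**  For every pair of levels `a, b` of the width-two strip, along `n_k = 2k + χ_a − χ_b`:
`P̂(k)_{ab} / (n_k · D̂(k)_{ab}) ⟶ √2 − 1/2 = 0.91421…`,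
i.e. a critical bridge of `S₂` with exactly `n` steps has `(√2 − ½)·n + o(n)` irreducible pieces (renewal vertices) under the weighting
`x_c^{n} y₂^{#top}`; equivalently the mean length of an irreducible piece under the invariant weighting is `(2 + 4√2)/7 = 1.0938…`.  From the
tree's elementary renewal theorem for the strip (`tendsto_pieces_per_step`, every `T ≥ 2`, limit `⟨ℓ,u⟩/⟨ℓ, M̄_len u⟩`) and the closed-form
Perron data of §7: `(22 − 20x²)/(20 − 8x²) = 3/2 − 2x² = √2 − 1/2`. [cite: Feller1968, XIII.3 (elementary renewal theorem), XIII.11; DuminilCopinHammond2013, §2.2 (renewal points); BeatonBousquetMelouDeGierDuminilCopinGuttmann2014, Corollary 8 (the strip at (x_c, y_T)); lane «pcv-sawmu» a-p2 g24 — own result, not in print] -/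
theorem widthTwo_pieces_per_step (a b : Fin (2 * 2)) :
    Tendsto (fun k : ℕ => (∑ l ∈ LUset 2 (2 * k + 1) (hatLen k a b) (a : ℕ) (b : ℕ), (npieces l : ℝ) * wD 2 (stripYT 2) l) /
        ((hatLen k a b : ℝ) * hatD 2 (stripYT 2) k a b)) atTop (𝓝 (Real.sqrt 2 - 1 / 2)) := by
  have h := tendsto_pieces_per_step (T := 2) le_rfl uTwo_pos ellTwo_pos Iinf_two_fixed.1 Iinf_two_fixed.2 a b
  rw [lengthMomentMatrix_two_eq, perron_scalars_two.1, perron_scalars_two.2] at h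
  have hval : (22 - 20 * hexCriticalFugacity ^ 2) / (20 - 8 * hexCriticalFugacity ^ 2) = Real.sqrt 2 - 1 / 2 := by
    have hP := xc_minpoly
    have hpos : 0 < 20 - 8 * hexCriticalFugacity ^ 2 := by nlinarith [xc_sq_bounds.2]
    rw [div_eq_iff hpos.ne', sqrt_two_eq]
    linear_combination (-8 : ℝ) * hP
  rwa [hval] at h



end HV

end Literature.Probability.RandomPlanarGeometry.SAW
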